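import Summits.Ventures.QEC.Census.CertCheck
import HarnessLib

/-!
# Distance certificates for CSS codes: the meet-in-the-middle lower-bound replay (CERT-FORMAT v1 §5.2, lemma L4)

An ADDITIVE module next to `CertCheck` (plan/CERT-FORMAT.md v1 §5.2 method `mitm`; director-qec ruling D11,
qec/INBOX 2026-08-26T19:06:38Z; kernel-A lower-bound side, qec-search-9). The brute-force replay of `CertCheck`
(`lowerOK` / `lowerChunk`) visits every support of weight `≤ wmax`; the meet-in-the-middle replay splits
`wmax = wa + wb` and replaces the visit of a weight-`≤ wmax` support by ONE table lookup per support of weight `≤ wa`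
and one per support of weight `≤ wb`:

* the certificate ships, per side, the TABLE of CERT-FORMAT §5.2 as a binary-search-tree literal `T : SynTree`
  (key = syndrome of a pattern `b` with `|b| ≤ wb`, value = the pattern word) and the position list
  `pos = posList n Hsyn`;
* (T1) `scan (tableTest T) pos wb 0 0`: every sub-selection `B` of `pos` with `|B| ≤ wb` is found in `T` under its
  own syndrome, `T.find (syn B) = some (word B)`;
* (T3) `scan (probeTest T n wmax allow) pos wa 0 0`: for every sub-selection `A` with `|A| ≤ wa`, `T.find (syn A)` is
  `none`, or `some b` with `word A ⊕ b = 0`, or `popc (word A ⊕ b) > wmax`, or `word A ⊕ b` allow-listed.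

SOUNDNESS (`mitm_scan_sound`, CERT-FORMAT §4 L4): for a sub-selection `S` of `pos` with `|S| ≤ wa + wb`, zero
syndrome and `popc (word S) ≤ wmax`, split `S = A ++ B` with `A = S.take wa`, `B = S.drop wa`; then `syn A = syn B`,
(T1) files `B` under `syn B`, so the probe of `A` meets `word B` and (T3) classifies `word S = word A ⊕ word B` as
`0` or allow-listed. NO property of the tree (ordering, balance) is used: `SynTree.find` is an arbitrary function;
the tree shape only bounds the kernel cost of a lookup by its depth. Consequence (completeness, not soundness):
(T1) can only pass when the tabled syndromes are pairwise distinct, i.e. when the code has no zero-syndrome word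
of weight `≤ 2·wb`; codes with stabilizers that light stay with `bruteforce` / `bz` (or a bucket-valued table, v2). Hence `mitm_lower_sound` has the conclusion
of `lower_sound`, and `DistCert.dZ_code_of_mitm` / `dX_code_of_mitm` assemble it with `checkStructure` exactly like
`dZ_code_of_chunks`.

KERNEL COST (measured, farm, 2026-08-26, BB `[[72,12,6]]`, `wmax = 5 = 3 + 2`, per side): `≈ 1.3·10⁵` scan nodes
and `6.5·10⁴` tree descents of depth `≤ 12` — `decide +kernel` in `≈ 35 s`, versus `≈ 3.0·10⁷` scan nodes for the
brute-force replay. `SynTree.find` is written with the primitive recursor and `Nat.blt` (3× faster in the kernel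
than the pattern-matching / `if _ < _` form); it is `noncomputable` (no compiled code is needed by `decide +kernel`).
-/

namespace Summit.Ventures.QEC.Census

open Matrix Literature.InformationTheory.QuantumCodes

/-! ## The table and the two leaf tests -/

/-- The shipped syndrome table of the meet-in-the-middle replay: a binary search tree literal, key = syndrome of a
tabled pattern, value = the pattern word (CERT-FORMAT §5.2 «table of syndromes of all b, |b| ≤ wb»). (definition) -/
inductive SynTree where
  /-- the empty tree -/
  | leaf : SynTree
  /-- a node: left subtree, key (syndrome), value (pattern word), right subtree -/
  | node (l : SynTree) (key val : ℕ) (r : SynTree) : SynTree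

/-- Lookup by key: descend comparing with `Nat.blt` (kernel-accelerated), written with the primitive recursor for
kernel speed under `decide +kernel`. Its correctness as a search is never used by the soundness proofs (it is treated
as an arbitrary function `ℕ → Option ℕ`). (definition) -/
noncomputable def SynTree.find (k : ℕ) (t : SynTree) : Option ℕ :=
  SynTree.rec (motive := fun _ => Option ℕ) none
    (fun _l key val _r fl fr => cond (Nat.blt k key) fl (cond (Nat.blt key k) fr (some val))) t

/-- (T1) leaf test: the tabled pattern word `v` is found under its own syndrome `s`. (definition) -/
noncomputable def tableTest (T : SynTree) (v s : ℕ) : Bool := T.find s == some v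

/-- Outcome of a probe word `v` against a table answer: `none` passes; `some b` passes iff `v ⊕ b` is `0`, has more
than `wmax` set bits among the first `n`, or is allow-listed. (definition) -/
def probeRes (n wmax : ℕ) (allow : List ℕ) (v : ℕ) : Option ℕ → Bool
  | none => true
  | some b => (v ^^^ b == 0) || decide (wmax < popc n (v ^^^ b)) || allow.elem (v ^^^ b)

/-- (T3) leaf test: probe the pattern word `v` with syndrome `s` against the table. (definition) -/
noncomputable def probeTest (T : SynTree) (n wmax : ℕ) (allow : List ℕ) (v s : ℕ) : Bool :=
  probeRes n wmax allow v (T.find s)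

/-- **The meet-in-the-middle lower-bound replay of one side** (CERT-FORMAT §5.2 with the table shipped as `T`):
`wmax = wa + wb`, the shipped position list is `posList n Hsyn`, (T1) every sub-selection of `≤ wb` positions is
tabled under its syndrome, (T3) every sub-selection of `≤ wa` positions probes clean against the allow-list `allow`.
The allow-list decompositions themselves are checked by `foundOK` (in `checkStructure`), as for `lowerChunk`.
(definition) -/
noncomputable def mitmLowerOK (n : ℕ) (Hsyn : List ℕ) (allow : List ℕ) (wmax wa wb : ℕ) (pos : List (ℕ × ℕ))
    (T : SynTree) : Bool :=
  (wmax == wa + wb) && (pos == posList n Hsyn) &&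
    scan (tableTest T) pos wb 0 0 && scan (probeTest T n wmax allow) pos wa 0 0

namespace DistCert

/-- The meet-in-the-middle replay of the `Z` side of a certificate (syndromes by `HX`, allow-list of `sideZ`,
`wmax = dZ − 1 = wa + wb`) against a shipped position list and table. (definition) -/
noncomputable def mitmZ (c : DistCert) (wa wb : ℕ) (pos : List (ℕ × ℕ)) (T : SynTree) : Bool :=
  mitmLowerOK c.n c.HX (c.sideZ.found.map Prod.fst) (c.dZ - 1) wa wb pos T

/-- The meet-in-the-middle replay of the `X` side of a certificate (syndromes by `HZ`, allow-list of `sideX`,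
`wmax = dX − 1 = wa + wb`). (definition) -/
noncomputable def mitmX (c : DistCert) (wa wb : ℕ) (pos : List (ℕ × ℕ)) (T : SynTree) : Bool :=
  mitmLowerOK c.n c.HZ (c.sideX.found.map Prod.fst) (c.dX - 1) wa wb pos T

end DistCert

/-! ## Soundness of the meet-in-the-middle replay (L4) -/

section MitmSoundness

/-- XOR of a concatenation of lists of numerals. -/
theorem xorList_append (l₁ l₂ : List ℕ) : xorList (l₁ ++ l₂) = xorList l₁ ^^^ xorList l₂ := by
  induction l₁ with
  | nil => simp [xorList]
  | cons a l ih => simp [xorList, ih, Nat.xor_assoc]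

/-- The word of a concatenated selection is the XOR of the words. -/
theorem xorFst_append (A B : List (ℕ × ℕ)) : xorFst (A ++ B) = xorFst A ^^^ xorFst B := by
  simp [xorFst, List.map_append, xorList_append]

/-- The syndrome of a concatenated selection is the XOR of the syndromes. -/
theorem xorSnd_append (A B : List (ℕ × ℕ)) : xorSnd (A ++ B) = xorSnd A ^^^ xorSnd B := by
  simp [xorSnd, List.map_append, xorList_append]

/-- **L4 (meet in the middle) at the word level.** If (T1) and (T3) hold for a position list `L`, then every
sub-selection `S` of `L` with `|S| ≤ wa + wb`, zero syndrome and at most `wmax` set bits in its word has word `0` or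
an allow-listed word. Proof: `S = A ++ B`, `A = S.take wa` (`|A| ≤ wa`), `B = S.drop wa` (`|B| ≤ wb`);
`syn A = syn B` since `syn S = 0`; (T1) files `B` under `syn B`, so the probe of `A` meets `word B`, and (T3)
classifies `word A ⊕ word B = word S`. (theorem) -/
theorem mitm_scan_sound {T : SynTree} {n wmax wa wb : ℕ} {allow : List ℕ} {L : List (ℕ × ℕ)}
    (hT1 : scan (tableTest T) L wb 0 0 = true) (hT3 : scan (probeTest T n wmax allow) L wa 0 0 = true)
    (S : List (ℕ × ℕ)) (hS : S.Sublist L) (hlen : S.length ≤ wa + wb) (hsyn : xorSnd S = 0)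
    (hpop : popc n (xorFst S) ≤ wmax) :
    xorFst S = 0 ∨ allow.elem (xorFst S) = true := by
  set A := S.take wa with hA
  set B := S.drop wa with hB
  have hAB : A ++ B = S := List.take_append_drop wa S
  have hAsub : A.Sublist L := (List.take_sublist wa S).trans hS
  have hBsub : B.Sublist L := (List.drop_sublist wa S).trans hS
  have hAlen : A.length ≤ wa := by rw [hA, List.length_take]; exact Nat.min_le_left _ _
  have hBlen : B.length ≤ wb := by rw [hB, List.length_drop]; omega
  -- (T1) at B: the table files `word B` under `syn B`
  have h1 := scan_sublist _ _ _ _ _ hT1 B hBsub hBlen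
  rw [Nat.zero_xor, Nat.zero_xor, tableTest, beq_iff_eq] at h1
  -- the syndromes of A and B agree
  have hsAB : xorSnd A = xorSnd B := by
    have h0 : xorSnd A ^^^ xorSnd B = 0 := by rw [← xorSnd_append, hAB, hsyn]
    have h2 : xorSnd A ^^^ (xorSnd A ^^^ xorSnd B) = xorSnd A := by rw [h0, Nat.xor_zero]
    rwa [← Nat.xor_assoc, Nat.xor_self, Nat.zero_xor, eq_comm] at h2
  -- (T3) at A
  have h3 := scan_sublist _ _ _ _ _ hT3 A hAsub hAlen
  rw [Nat.zero_xor, Nat.zero_xor, probeTest, hsAB, h1, probeRes] at h3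
  have hw : xorFst A ^^^ xorFst B = xorFst S := by rw [← xorFst_append, hAB]
  rw [hw] at h3
  simp only [Bool.or_eq_true, beq_iff_eq, decide_eq_true_eq] at h3
  rcases h3 with (h0 | hlt) | hmem
  · exact Or.inl h0
  · exact absurd hlt (not_lt.mpr hpop)
  · exact Or.inr hmem

variable {n : ℕ} {Hsyn Hstab : List ℕ}

/-- **Lower bound from the meet-in-the-middle replay** (same conclusion as `lower_sound`): if the allow-list
decomposes over the stabilizer rows and `mitmLowerOK` passes with budget `wmax`, then every logical operator (zero
`Hsyn`-syndrome, outside the `Hstab` row space) has weight `> wmax`. (theorem) -/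
theorem mitm_lower_sound {wmax wa wb : ℕ} {found : List (ℕ × List ℕ)} {pos : List (ℕ × ℕ)} {T : SynTree}
    (hfound : foundOK Hstab found = true)
    (hmitm : mitmLowerOK n Hsyn (found.map Prod.fst) wmax wa wb pos T = true) (w : Fin n → ZMod 2)
    (hw : rowMatrix n Hsyn *ᵥ w = 0) (hw' : w ∉ rowSpace (rowMatrix n Hstab)) : wmax < hammingNorm w := by
  simp only [foundOK, List.all_eq_true, beq_iff_eq] at hfound
  simp only [mitmLowerOK, Bool.and_eq_true, beq_iff_eq] at hmitm
  obtain ⟨⟨⟨hwab, hpos⟩, hT1⟩, hT3⟩ := hmitm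
  subst hpos
  by_contra hle
  rw [not_lt] at hle
  have hlen : (suppList n Hsyn w).length ≤ wa + wb := by rw [length_suppList, ← hwab]; exact hle
  have hpop : popc n (xorFst (suppList n Hsyn w)) ≤ wmax := by
    rw [← hammingNorm_ofBits, ofBits_xorFst_suppList]; exact hle
  have hS := mitm_scan_sound hT1 hT3 (suppList n Hsyn w) (suppList_sublist n Hsyn w) hlen
    (xorSnd_suppList_eq_zero n Hsyn w hw) hpop
  rcases hS with h0 | hmem
  · apply hw'
    rw [← ofBits_xorFst_suppList n Hsyn w, h0, ofBits_zero]
    exact Submodule.zero_mem _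
  · apply hw'
    rw [← ofBits_xorFst_suppList n Hsyn w]
    obtain ⟨e, he, hex⟩ : ∃ e ∈ found, e.1 = xorFst (suppList n Hsyn w) := by
      simpa [List.mem_map] using List.mem_of_elem_eq_true hmem
    rw [← hex, ← hfound e he]
    exact ofBits_xorRows_mem_rowSpace n Hstab e.2

/-- Soundness of one side, meet-in-the-middle form: the upper witness and the mitm replay with `wmax = d − 1` give
the (witness, universal lower bound) pair of type-02's `CSSCode.dX_eq_of_witness`, as `sideOK_sound` does for the
brute-force replay. (theorem) -/
theorem side_sound_of_mitm {s : SideCert} {wa wb : ℕ} {pos : List (ℕ × ℕ)} {T : SynTree}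
    (hup : upperOK n Hsyn Hstab s.d s.witness s.nonmember = true) (hfound : foundOK Hstab s.found = true)
    (hmitm : mitmLowerOK n Hsyn (s.found.map Prod.fst) (s.d - 1) wa wb pos T = true) :
    ∃ v : Fin n → ZMod 2, rowMatrix n Hsyn *ᵥ v = 0 ∧ v ∉ rowSpace (rowMatrix n Hstab) ∧ hammingNorm v = s.d ∧
      ∀ w : Fin n → ZMod 2, rowMatrix n Hsyn *ᵥ w = 0 → w ∉ rowSpace (rowMatrix n Hstab) →
        s.d ≤ hammingNorm w := by
  obtain ⟨hv, hv', hwt⟩ := upper_sound hup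
  refine ⟨ofBits n s.witness, hv, hv', hwt, fun w hw hw' => ?_⟩
  have := mitm_lower_sound hfound hmitm w hw hw'
  omega

end MitmSoundness

/-! ## Soundness of the checker, meet-in-the-middle form -/

namespace DistCert

variable (c : DistCert)

/-- **Soundness, `Z` side, meet in the middle**: the structural check (commutation, upper witnesses, allow-list
decompositions) and a passing `Z`-side mitm replay give `Z`-distance `c.dZ`. (theorem) -/
theorem dZ_code_of_mitm {wa wb : ℕ} {pos : List (ℕ × ℕ)} {T : SynTree} (hs : c.checkStructure = true)
    (hZ : c.mitmZ wa wb pos T = true) : (c.code (c.commOK_of_checkStructure hs)).dZ = c.dZ := by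
  have h' := hs
  simp only [checkStructure, Bool.and_eq_true] at h'
  obtain ⟨v, hv, hv', hwt, hall⟩ := side_sound_of_mitm (s := c.sideZ) h'.1.1.1.2 h'.1.1.2 hZ
  exact (c.code _).dZ_eq_of_witness hv hv' hwt hall

/-- **Soundness, `X` side, meet in the middle**: the structural check and a passing `X`-side mitm replay give
`X`-distance `c.dX`. (theorem) -/
theorem dX_code_of_mitm {wa wb : ℕ} {pos : List (ℕ × ℕ)} {T : SynTree} (hs : c.checkStructure = true)
    (hX : c.mitmX wa wb pos T = true) : (c.code (c.commOK_of_checkStructure hs)).dX = c.dX := by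
  have h' := hs
  simp only [checkStructure, Bool.and_eq_true] at h'
  obtain ⟨v, hv, hv', hwt, hall⟩ := side_sound_of_mitm (s := c.sideX) h'.1.2 h'.2 hX
  exact (c.code _).dX_eq_of_witness hv hv' hwt hall

end DistCert

/-! ## Control (CERT-REQS A1): the `[[4,2,2]]` certificate of `CertCheck`, replayed meet-in-the-middle -/

/-- The mitm table for either side of `[[4,2,2]]` with `wb = 0`: the empty pattern only (syndrome `0 ↦` word `0`).
(definition) -/
def treeC422 : SynTree := .node .leaf 0 0 .leaf

/-- The `Z`-side mitm replay (`wmax = 1 = 1 + 0`) of the `[[4,2,2]]` certificate passes (by `decide`, KERNEL). -/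
theorem mitmZ_certC422 : certC422.mitmZ 1 0 (posList 4 certC422.HX) treeC422 = true := by decide

/-- The `X`-side mitm replay of the `[[4,2,2]]` certificate passes (by `decide`, KERNEL). -/
theorem mitmX_certC422 : certC422.mitmX 1 0 (posList 4 certC422.HZ) treeC422 = true := by decide

/-- The structural check of the `[[4,2,2]]` certificate passes. -/
theorem checkStructure_certC422 : certC422.checkStructure = true := by decide

/-- `d_Z = 2` for the `[[4,2,2]]` code via the meet-in-the-middle replay, CERTIFIED. -/
theorem dZ_certC422_mitm : (certC422.code (certC422.commOK_of_checkStructure checkStructure_certC422)).dZ = 2 :=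
  certC422.dZ_code_of_mitm checkStructure_certC422 mitmZ_certC422

/-- `d_X = 2` for the `[[4,2,2]]` code via the meet-in-the-middle replay, CERTIFIED. -/
theorem dX_certC422_mitm : (certC422.code (certC422.commOK_of_checkStructure checkStructure_certC422)).dX = 2 :=
  certC422.dX_code_of_mitm checkStructure_certC422 mitmX_certC422

end Summit.Ventures.QEC.Census
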